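import Mathlib.MeasureTheory.Integral.Bochner.Set
import Mathlib.MeasureTheory.Measure.Lebesgue.Basic
import Mathlib.Topology.Compactness.Compact
import Mathlib.Topology.MetricSpace.Pseudo.Defs
import Literature.Dynamics.TopologicalDynamics.UniformRecurrence
import HarnessLib

/-!
# The recurrence-upgrade lemma (stub S2 of line `Ideator5Round2Sketch`, crux `RecurrentLiouville`)

Topological dynamics, no PDE.  For a jointly continuous `ℝ`-action `ϕ` on a COMPACT space `X`
(action law `ϕ (s + t) = ϕ s ∘ ϕ t`, `ϕ 0 = id`), a continuous observable `φ ≥ 0` and a uniformly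
recurrent point `x` (`Literature.Dynamics.TopologicalDynamics.IsUniformlyRecurrentPt`, Furstenberg
1981 Ch. 1 §4 Def. 1.8): if `s ↦ φ (ϕ s x)` is integrable on `[0, ∞)` then `φ x = 0`
(`recurrenceUpgrade_pt`; registered stub `stub_recurrenceUpgrade` of crux item
stmt-NavierStokesRegularity-1589, skeleton `Cruxes/RecurrentLiouville/Lines/Ideator5Round2Sketch.lean`).

"Integrable defect + recurrent ⇒ zero defect": this is the one place where uniform recurrence has
teeth beyond compactness — it converts an almost-monotonicity with integrable defect along one
orbit into an exact identity at the base point (and, applied along the orbit, on the whole hull).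

Proof (folklore): if `a := φ x > 0`, the closed superlevel set `{φ ≥ a/2}` is compact, so by the
generalized tube lemma there is `τ > 0` with `φ (ϕ h y) > a/4` for `0 ≤ h ≤ τ` whenever `φ y ≥ a/2`
(`exists_tube_of_superlevel`); the return times of `x` to the open set `{φ > a/2}` are syndetic,
i.e. every window `[b, b + L]` contains one (`isSyndetic_iff_exists_window`); but integrability on
`[0, ∞)` forces the tail integrals `∫_{[n,∞)} φ (ϕ s x) ds → 0` (`tendsto_setIntegral_of_antitone`),
while a return time `t ≥ n` gives `∫_{[n,∞)} ≥ ∫_{[t, t+τ]} ≥ τ a / 4` — contradiction.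

## References

* H. Furstenberg, *Recurrence in Ergodic Theory and Combinatorial Number Theory*, Princeton UP
  (1981), Ch. 1 §4 (Def. 1.7 syndetic, Def. 1.8 uniformly recurrent).
-/

-- the sub-problem namespace repeats the summit name (D-0017 layout `Summit.<S>.<P>.Theorems`)
set_option linter.dupNamespace false

namespace Summit.NavierStokesRegularity.NavierStokesRegularity.Theorems

open MeasureTheory Set Filter Topology
open Literature.Dynamics.TopologicalDynamics

variable {X : Type*} [TopologicalSpace X]

/-- **Uniform tube over a compact superlevel set.** For a jointly continuous `ℝ`-action `ϕ` with
`ϕ 0 = id` on a compact space, a continuous `φ` and `a > 0`, there is `τ > 0` such that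
`φ (ϕ h y) > a / 4` for all `h ∈ [0, τ]` and all `y` with `φ y ≥ a / 2` (generalized tube lemma
applied to `{0} × {φ ≥ a/2}` inside the open set `{(h, y) | φ (ϕ h y) > a/4}`). [folklore] -/
theorem exists_tube_of_superlevel [CompactSpace X] {ϕ : ℝ → X → X}
    (hcont : Continuous fun p : ℝ × X => ϕ p.1 p.2) (h0 : ∀ y, ϕ 0 y = y)
    {φ : X → ℝ} (hφ : Continuous φ) {a : ℝ} (ha : 0 < a) :
    ∃ τ : ℝ, 0 < τ ∧ ∀ h ∈ Icc (0 : ℝ) τ, ∀ y, a / 2 ≤ φ y → a / 4 < φ (ϕ h y) := by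
  have hK : IsCompact {y : X | a / 2 ≤ φ y} := (isClosed_le continuous_const hφ).isCompact
  have hn : IsOpen {p : ℝ × X | a / 4 < φ (ϕ p.1 p.2)} :=
    isOpen_lt continuous_const (hφ.comp hcont)
  have hp : ({0} : Set ℝ) ×ˢ {y : X | a / 2 ≤ φ y} ⊆ {p : ℝ × X | a / 4 < φ (ϕ p.1 p.2)} := by
    rintro ⟨h, y⟩ ⟨hh, hy⟩
    simp only [mem_singleton_iff] at hh
    subst hh
    simp only [mem_setOf_eq] at hy ⊢
    rw [h0]
    linarith
  obtain ⟨u, v, hu, -, h0u, hKv, huv⟩ := generalized_tube_lemma isCompact_singleton hK hn hp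
  obtain ⟨δ, hδ, hball⟩ := Metric.isOpen_iff.1 hu 0 (h0u (mem_singleton 0))
  refine ⟨δ / 2, by positivity, fun h hh y hy => ?_⟩
  have hhu : h ∈ u := hball (by
    rw [Metric.mem_ball, Real.dist_eq, sub_zero, abs_lt]
    constructor <;> linarith [hh.1, hh.2])
  exact huv (mk_mem_prod hhu (hKv hy))

/-- **Recurrence upgrade** (pointwise form): on a compact phase space, a continuous observable
`φ ≥ 0` with `∫₀^∞ φ (ϕ s x) ds < ∞` along the orbit of a uniformly recurrent point `x` of a jointly
continuous `ℝ`-action vanishes at `x`. [folklore] -/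
theorem recurrenceUpgrade_pt [CompactSpace X] {ϕ : ℝ → X → X}
    (hcont : Continuous fun p : ℝ × X => ϕ p.1 p.2) (hadd : ∀ s t y, ϕ (s + t) y = ϕ s (ϕ t y))
    (h0 : ∀ y, ϕ 0 y = y) {φ : X → ℝ} (hφ : Continuous φ) (hφ0 : ∀ y, 0 ≤ φ y) {x : X}
    (hrec : IsUniformlyRecurrentPt ϕ x) (hint : IntegrableOn (fun s => φ (ϕ s x)) (Ici 0)) :
    φ x = 0 := by
  by_contra hne
  have ha : 0 < φ x := lt_of_le_of_ne (hφ0 x) (Ne.symm hne)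
  -- uniform tube over the compact superlevel set `{φ ≥ φ x / 2}`
  obtain ⟨τ, hτ, htube⟩ := exists_tube_of_superlevel hcont h0 hφ ha
  -- the return times of `x` to the open superlevel set `{φ > φ x / 2}` are relatively dense
  have hU : {y : X | φ x / 2 < φ y} ∈ 𝓝 x :=
    (isOpen_lt continuous_const hφ).mem_nhds (by simp only [mem_setOf_eq]; linarith)
  obtain ⟨L, -, hret⟩ := isSyndetic_iff_exists_window.1 (hrec _ hU)
  -- the tail integrals over `[n, ∞)` tend to zero
  have htail : Tendsto (fun n : ℕ => ∫ s in Ici (n : ℝ), φ (ϕ s x)) atTop (𝓝 0) := by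
    have h1 := tendsto_setIntegral_of_antitone (μ := volume) (f := fun s => φ (ϕ s x))
      (s := fun n : ℕ => Ici (n : ℝ)) (fun _ => measurableSet_Ici)
      (fun m n hmn => Ici_subset_Ici.2 (by exact_mod_cast hmn)) ⟨0, by simpa using hint⟩
    have h2 : (⋂ n : ℕ, Ici (n : ℝ)) = ∅ := by
      ext s
      simp only [mem_iInter, mem_Ici, mem_empty_iff_false, iff_false, not_forall, not_le]
      exact exists_nat_gt s
    simpa only [h2, Measure.restrict_empty, integral_zero_measure] using h1
  have hpos : 0 < τ * (φ x / 4) := by positivity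
  obtain ⟨n, hn⟩ := (htail.eventually (gt_mem_nhds hpos)).exists
  -- a return time `t ≥ n`, and the interval `[t, t + τ] ⊆ [n, ∞)` on which the integrand is large
  obtain ⟨t, ht, htU⟩ := hret n
  have htU' : φ x / 2 < φ (ϕ t x) := htU
  have hsub : Icc t (t + τ) ⊆ Ici (n : ℝ) := fun s hs => le_trans ht.1 hs.1
  have hint_n : IntegrableOn (fun s => φ (ϕ s x)) (Ici (n : ℝ)) :=
    hint.mono_set (Ici_subset_Ici.2 (Nat.cast_nonneg n))
  have hlarge : ∀ s ∈ Icc t (t + τ), φ x / 4 ≤ φ (ϕ s x) := by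
    intro s hs
    have hs' : ϕ s x = ϕ (s - t) (ϕ t x) := by rw [← hadd, sub_add_cancel]
    rw [hs']
    exact (htube (s - t) ⟨by linarith [hs.1], by linarith [hs.2]⟩ (ϕ t x) htU'.le).le
  have hlower : τ * (φ x / 4) ≤ ∫ s in Ici (n : ℝ), φ (ϕ s x) :=
    calc τ * (φ x / 4) = ∫ _ in Icc t (t + τ), φ x / 4 := by
            rw [setIntegral_const, Real.volume_real_Icc_of_le (by linarith), smul_eq_mul]
            ring
      _ ≤ ∫ s in Icc t (t + τ), φ (ϕ s x) :=
            setIntegral_mono_on (integrableOn_const (by simp [Real.volume_Icc]))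
              (hint_n.mono_set hsub) measurableSet_Icc hlarge
      _ ≤ ∫ s in Ici (n : ℝ), φ (ϕ s x) :=
            setIntegral_mono_set hint_n (ae_of_all _ fun s => hφ0 _) hsub.eventuallyLE
  linarith

/-- **Registered stub S2 `stub_recurrenceUpgrade`** of crux stmt-NavierStokesRegularity-1589
(line `Ideator5Round2Sketch`): the recurrence upgrade in the skeleton's binder form. [folklore] -/
theorem stub_recurrenceUpgrade :
    ∀ {X : Type*} [TopologicalSpace X] [CompactSpace X] (ϕ : ℝ → X → X), Continuous (fun p : ℝ × X => ϕ p.1 p.2) → (∀ s t y, ϕ (s + t) y = ϕ s (ϕ t y)) → (∀ y, ϕ 0 y = y) → ∀ (φ : X → ℝ), Continuous φ → (∀ y, 0 ≤ φ y) → ∀ (x : X), Literature.Dynamics.TopologicalDynamics.IsUniformlyRecurrentPt ϕ x → MeasureTheory.IntegrableOn (fun s => φ (ϕ s x)) (Set.Ici 0) → φ x = 0 :=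
  fun _ hcont hadd h0 _ hφ hφ0 _ hrec hint => recurrenceUpgrade_pt hcont hadd h0 hφ hφ0 hrec hint

end Summit.NavierStokesRegularity.NavierStokesRegularity.Theorems
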